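import Literature.NumberTheory.EllipticCurves.NeronModelSourceLocal
import Literature.NumberTheory.EllipticCurves.NeronModelSchematic
import Literature.AlgebraicGeometry.Limits.LocalizationProdLimit
import Mathlib.Algebra.Category.Ring.Instances
import HarnessLib

/-!
# The local criterion for the Néron property at a closed point

Sixth file of the existence programme for Néron models
(`Literature.NumberTheory.EllipticCurves.NeronModelExistence`; see `NeronModelBaseChange`,
`NeronModelGroupStructure`, `NeronModelLocal`, `NeronModelSchematic`, `NeronModelSourceLocal`,
`NeronModelGluing`, `NeronModelTwoOpens`). Main result
(`IsSchematicNeronModel.of_away_of_atPrime`): let `R → K` be a ring with a field of fractions,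
`f ≠ 0`, and `𝔭` a prime ideal of `R` which is the only prime containing `f` (for a Dedekind
domain: the only maximal ideal containing `f`), so that `Spec R = D(f) ∪ {𝔭}`. Let `𝒩 → Spec R` be
smooth, separated and of finite type. If `𝒩 ×_R R[1/f]` is a Néron model of the `K`-scheme `E`
over (the models of) `R[1/f]` and `𝒩 ×_R R_𝔭` is a Néron model of `E` over (the models of) the
local ring `R_𝔭` — both in the group-free sense `IsSchematicNeronModel` of
`NeronModelGroupStructure` — then `𝒩` is a Néron model of `E` over `R`
(`IsSchematicNeronModel.of_away_of_atPrime_of_models` is the same statement for *given* models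
`R_f`, `R_𝔭` of `R[1/f]`, `R_𝔭` and the hypotheses over these models only; the proof uses nothing
else).

This is the verification step of the passage from local to global Néron models over a Dedekind
scheme (Bosch–Lütkebohmert–Raynaud, *Néron Models*, §1.4; it combines the local nature of Néron
models, §1.2 Prop. 4, with the limit arguments of EGA IV₃ §8 relating `R_𝔭 = colim_{s ∉ 𝔭} R[1/s]`
to the open neighbourhoods `D(s)` of `𝔭`). It reduces the one-bad-prime gluing fact
`exists_isNeronModel_of_away_of_atPrime_of_unique` of `NeronModelGluing` to the construction of
an `R`-model of the local Néron model agreeing with the given model over `D(f)`.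

## Proof

By `bijective_map_of_isAffine` (`NeronModelSourceLocal`) it suffices to check the mapping
property for smooth `R`-schemes `𝒳` with affine total space (then `𝒳 → Spec R` is quasi-compact
and quasi-separated). *Injectivity*: two `R`-morphisms `𝒳 → 𝒩` with the same generic fibre agree
on `𝒳 ⊗ Spec R[1/f]` (mapping property over `D(f)`, `S`-form `bijective_map_of_fac` of
`NeronModelLocal`) and on `𝒳 ⊗ Spec R_𝔭` (mapping property over `R_𝔭`, tensor form
`bijective_map_tensor` of `NeronModelSourceLocal`; `Spec R_𝔭 → Spec R` is a monomorphism,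
`mono_specOfAlgebraMap_of_isLocalization`), hence on `𝒳 ⊗ Spec R[1/t]` for some `t ∉ 𝔭`
(`LocApprox.exists_whiskerLeft_map_comp_eq` of `Limits/LocalizationProdLimit`:
`𝒳 ⊗ Spec R_𝔭 = lim_{s ∉ 𝔭} 𝒳 ⊗ Spec R[1/s]` and `𝒩` is locally of finite type), hence
everywhere since `Spec R = D(f) ∪ D(t)`. *Surjectivity*: a `K`-morphism `u : 𝒳_K → 𝒩_K` extends to
`g_f` on `𝒳 ⊗ Spec R[1/f]` and to `v` on `𝒳 ⊗ Spec R_𝔭`; `v` spreads out to `w` on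
`𝒳 ⊗ Spec R[1/s]` for some `s ∉ 𝔭` (`LocApprox.exists_whiskerLeft_comp_eq`, `𝒩` being locally of
finite presentation), with the right generic fibre because the projections
`𝒳 ⊗ Spec R_𝔭 → 𝒳`, `𝒳 ⊗ Spec R[1/s] → 𝒳` are isomorphisms on generic fibres
(`isIso_pullback_map_fst`); `g_f` and `w` agree on the overlap, which lies over `D(f)`
(injectivity of the mapping property over `D(f)` in `S`-form), and glue along the open cover
`𝒳 = 𝒳|_{D(f)} ∪ 𝒳|_{D(s)}` (`Scheme.Cover.glueMorphisms`); the glued morphism has generic fibre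
`u` because `𝒳 ⊗ Spec R[1/f] → 𝒳` is an isomorphism on generic fibres.

## References

* S. Bosch, W. Lütkebohmert, M. Raynaud, *Néron Models*, Springer 1990, §1.2 (Def. 1, Prop. 4),
  §1.4 (local-to-global passage over a Dedekind scheme). [BLRNeronModels1990]
* A. Grothendieck, EGA IV₃, Thm. 8.8.2 (Publ. Math. IHÉS 28, 1966). [EGAIV3]
* The Stacks project, Tag 01ZC. [StacksProject]
-/

noncomputable section

universe u

namespace Literature.NumberTheory.EllipticCurves

open _root_.AlgebraicGeometry CategoryTheory Limits MonoidalCategory CartesianMonoidalCategory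
open Literature.AlgebraicGeometry.Limits
open Literature.AlgebraicGeometry.Motives (SchemeOver specOver)
open scoped CategoryTheory.Obj

section LocalCriterion

variable {R : Type u} [CommRing R] {K : Type u} [Field K] [Algebra R K] [IsFractionRing R K]
  {𝒩 : Over (Spec (.of R))} {E : Over (Spec (.of K))}

/-- `Spec` of a localization map is a monomorphism of schemes (a localization is an epimorphism
of rings, Mathlib `IsLocalization.epi`, and `Scheme.Spec` is a right adjoint). [folklore] -/
theorem mono_specOfAlgebraMap_of_isLocalization (M : Submonoid R) (R' : Type u) [CommRing R']
    [Algebra R R'] [IsLocalization M R'] : Mono (specOfAlgebraMap R R') := by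
  haveI : Epi (CommRingCat.ofHom (algebraMap R R')) := IsLocalization.epi M R'
  exact inferInstanceAs (Mono (Scheme.Spec.map (CommRingCat.ofHom (algebraMap R R')).op))

/-- **Local criterion for the Néron property at one closed point, for given models** of `R[1/f]`
and `R_𝔭` (the verification step of the local-to-global passage in Bosch–Lütkebohmert–Raynaud,
*Néron Models*, §1.4, via the local nature of Néron models, §1.2 Prop. 4, and the limit arguments
of EGA IV₃ §8). Let `R → K` be a ring with a field of fractions, `f ∈ R` and `𝔭` a prime of `R`
such that `𝔭` is the only prime containing `f` (so `Spec R = D(f) ∪ {𝔭}`). Let `𝒩 → Spec R` be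
smooth, separated and of finite type, let `R_f`, `R_𝔭` be models of `R[1/f]` and of the local ring
at `𝔭` mapping compatibly to `K`, and suppose that `𝒩 ×_R R_f` is a Néron model of the `K`-scheme
`E` over `R_f` and `𝒩 ×_R R_𝔭` one over `R_𝔭`, in the group-free sense `IsSchematicNeronModel`.
Then `𝒩` is a Néron model of `E` over `R`. Proof of the mapping property, for a smooth `R`-scheme
`𝒳` which we may take affine (`bijective_map_of_isAffine`): a morphism `𝒳_K → 𝒩_K` extends over
`𝒳 ×_R R_f` (Néron property over `D(f)`) and over `𝒳 ×_R R_𝔭` (Néron property over `R_𝔭`); the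
latter extension spreads out to `𝒳 ×_R R[1/s]` for some `s ∉ 𝔭` because
`𝒳 ×_R R_𝔭 = lim_{s ∉ 𝔭} 𝒳 ×_R R[1/s]` and `𝒩` is locally of finite presentation
(`LocApprox.exists_whiskerLeft_comp_eq`, Stacks 01ZC); the two extensions agree on the overlap,
which lies over `D(f)`, and glue along `Spec R = D(f) ∪ D(s)`. Uniqueness likewise: two
extensions agree over `D(f)`, agree after base change to `R_𝔭`, hence over some `D(s)`
(`LocApprox.exists_whiskerLeft_map_comp_eq`), hence everywhere.
[cite: BLRNeronModels1990, §1.2 (Prop. 4, local nature) and §1.4 (local-to-global passage)] -/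
theorem IsSchematicNeronModel.of_away_of_atPrime_of_models (f : R) (p : Ideal R) [p.IsPrime]
    (hV : ∀ q : Ideal R, q.IsPrime → f ∈ q → q = p)
    (hsm : Smooth 𝒩.hom) (hsep : IsSeparated 𝒩.hom) (hlft : LocallyOfFiniteType 𝒩.hom)
    (hqc : QuasiCompact 𝒩.hom)
    (R₁ : Type u) [CommRing R₁] [Algebra R R₁] [IsLocalization.Away f R₁] [Algebra R₁ K]
    [IsScalarTower R R₁ K]
    (Rp : Type u) [CommRing Rp] [Algebra R Rp] [IsLocalization.AtPrime Rp p] [Algebra Rp K]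
    [IsScalarTower R Rp K]
    (HF₁ : IsSchematicNeronModel R₁ K ((Over.pullback (specOfAlgebraMap R R₁)).obj 𝒩) E)
    (HP : IsSchematicNeronModel Rp K ((Over.pullback (specOfAlgebraMap R Rp)).obj 𝒩) E) :
    IsSchematicNeronModel R K 𝒩 E := by
  classical
  -- work with the model `Localization.Away f` of `R[1/f]` (the charts of the covers below)
  have hfK : IsUnit (algebraMap R K f) := by
    rw [IsScalarTower.algebraMap_apply R R₁ K]
    exact (IsLocalization.Away.algebraMap_isUnit f).map _
  let Rf := Localization.Away f
  letI : Algebra Rf K := (IsLocalization.Away.lift f hfK).toAlgebra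
  haveI : IsScalarTower R Rf K :=
    IsScalarTower.of_algebraMap_eq fun x => (IsLocalization.Away.lift_eq f hfK x).symm
  have HF : IsSchematicNeronModel Rf K ((Over.pullback (specOfAlgebraMap R Rf)).obj 𝒩) E :=
    HF₁.of_isLocalization_away f R₁ Rf
  have hpc : ∀ y : p.primeCompl, IsUnit (algebraMap R K y) := fun y =>
    isUnit_iff_ne_zero.mpr ((map_ne_zero_iff _ (IsFractionRing.injective R K)).mpr
      fun h => y.2 (h ▸ p.zero_mem))
  -- the charts `D(f) = Spec R_f → Spec R` (open) and `Spec R_𝔭 → Spec R` (mono)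
  haveI : IsOpenImmersion (specOfAlgebraMap R Rf) := IsOpenImmersion.of_isLocalization f
  haveI : Mono (specOfAlgebraMap R Rp) := mono_specOfAlgebraMap_of_isLocalization p.primeCompl Rp
  have hφf : specGenericPoint Rf K ≫ (specOfAlgebraMap R Rf) = specGenericPoint R K :=
    specGenericPoint_comp_specOfAlgebraMap R K Rf
  have hφp : specGenericPoint Rp K ≫ (specOfAlgebraMap R Rp) = specGenericPoint R K :=
    specGenericPoint_comp_specOfAlgebraMap R K Rp
  have hsmf : Smooth (specOver R Rf).hom := by
    change Smooth (specOfAlgebraMap R Rf)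
    infer_instance
  refine
    { smooth := hsm
      isSeparated := hsep
      locallyOfFiniteType := hlft
      quasiCompact := hqc
      nonempty_iso := nonempty_iso_of_pullback_pullback (specOfAlgebraMap R Rf) _ hφf 𝒩 E HF.nonempty_iso
      mappingProperty := ?_ }
  haveI := hsm
  haveI := hlft
  refine bijective_map_of_isAffine (specGenericPoint R K) 𝒩 ?_
  intro 𝒳 h𝒳 h𝒳aff
  haveI := h𝒳aff
  haveI : IsAffineHom 𝒳.hom := isAffineHom_of_isAffine 𝒳.hom
  -- the mapping property over `D(f)` (`S`-form) and over `R_𝔭` (tensor form)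
  have MPf : ∀ 𝒴 : Over (Spec (.of R)), Smooth 𝒴.hom → ∀ q : 𝒴.left ⟶ Spec (.of Rf),
      q ≫ (specOfAlgebraMap R Rf) = 𝒴.hom → Function.Bijective fun k : 𝒴 ⟶ 𝒩 => (genericFibre R K).map k :=
    fun 𝒴 h𝒴 q hq =>
      bijective_map_of_fac (specOfAlgebraMap R Rf) (specGenericPoint Rf K) hφf 𝒩 HF.mappingProperty 𝒴 h𝒴 q hq
  have MPp : Function.Bijective fun k : 𝒳 ⊗ specOver R Rp ⟶ 𝒩 => (genericFibre R K).map k :=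
    bijective_map_tensor (specOfAlgebraMap R Rp) (specGenericPoint Rp K) hφp 𝒩 𝒳 (HP.mappingProperty _ (by
      change Smooth (pullback.snd 𝒳.hom (specOfAlgebraMap R Rp))
      exact MorphismProperty.pullback_snd _ _ h𝒳))
  -- smoothness of the pieces `𝒳 ⊗ Spec R_f`, `𝒳 ⊗ Spec R[1/s]`
  have hXf : Smooth (𝒳 ⊗ specOver R Rf).hom := smooth_tensorObj_hom_of_smooth h𝒳 hsmf
  have hXs : ∀ s : LocApprox.Idx p.primeCompl,
      Smooth (𝒳 ⊗ (LocApprox.baseDiagram p.primeCompl).obj s).hom := fun s =>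
    smooth_tensorObj_hom_of_smooth h𝒳 inferInstance
  have hqf : pullback.snd 𝒳.hom (specOfAlgebraMap R Rf) ≫ (specOfAlgebraMap R Rf) = (𝒳 ⊗ specOver R Rf).hom := pullback.condition.symm
  have MPXf := MPf (𝒳 ⊗ specOver R Rf) hXf (pullback.snd 𝒳.hom (specOfAlgebraMap R Rf)) hqf
  -- `D(f) ∪ D(s) = Spec R` for `s ∉ 𝔭`, and the corresponding open cover of `𝒳`
  let av : LocApprox.Idx p.primeCompl → Bool → R := fun s b => Bool.rec s.val f b
  have hspan : ∀ s : LocApprox.Idx p.primeCompl, Ideal.span (Set.range (av s)) = ⊤ := by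
    intro s
    by_contra hne
    obtain ⟨m, hm, hle⟩ := Ideal.exists_le_maximal _ hne
    have hfm : f ∈ m := hle (Ideal.subset_span ⟨true, rfl⟩)
    have hsm' : s.val ∈ m := hle (Ideal.subset_span ⟨false, rfl⟩)
    exact s.mem ((hV m hm.isPrime hfm) ▸ hsm')
  constructor
  · -- injectivity
    intro k₁ k₂ hk
    have hk' : (genericFibre R K).map k₁ = (genericFibre R K).map k₂ := hk
    have ef : fst 𝒳 (specOver R Rf) ≫ k₁ = fst 𝒳 (specOver R Rf) ≫ k₂ :=
      MPXf.1 (by simp only [Functor.map_comp]; rw [hk'])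
    have ep : fst 𝒳 (specOver R Rp) ≫ k₁ = fst 𝒳 (specOver R Rp) ≫ k₂ :=
      MPp.1 (by simp only [Functor.map_comp]; rw [hk'])
    obtain ⟨t, ht, et⟩ := LocApprox.exists_whiskerLeft_map_comp_eq (S := p.primeCompl) Rp
      (P := 𝒳) (X := 𝒩) (s := default) (fst 𝒳 _ ≫ k₁) (fst 𝒳 _ ≫ k₂) (by
        rw [whiskerLeft_fst_assoc, whiskerLeft_fst_assoc]
        exact ep)
    rw [whiskerLeft_fst_assoc, whiskerLeft_fst_assoc] at et
    let 𝒰 : (Spec (CommRingCat.of R)).OpenCover :=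
      (Scheme.affineOpenCoverOfSpanRangeEqTop (R := .of R) (av t) (hspan t)).openCover
    let 𝒱 : 𝒳.left.OpenCover := 𝒰.pullback₁ 𝒳.hom
    ext : 1
    refine Scheme.Cover.hom_ext 𝒱 _ _ fun b => ?_
    cases b
    · exact congrArg CommaMorphism.left et
    · exact congrArg CommaMorphism.left ef
  · -- surjectivity
    intro u
    obtain ⟨gf, hgf⟩ := MPXf.2 ((genericFibre R K).map (fst 𝒳 (specOver R Rf)) ≫ u)
    obtain ⟨v, hv⟩ := MPp.2 ((genericFibre R K).map (fst 𝒳 (specOver R Rp)) ≫ u)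
    have hgf' : (genericFibre R K).map gf = (genericFibre R K).map (fst 𝒳 (specOver R Rf)) ≫ u :=
      hgf
    have hv' : (genericFibre R K).map v = (genericFibre R K).map (fst 𝒳 (specOver R Rp)) ≫ u := hv
    -- spread `v` out to `𝒳 ⊗ Spec R[1/s]`
    obtain ⟨s, w, hw⟩ :=
      LocApprox.exists_whiskerLeft_comp_eq (S := p.primeCompl) Rp (P := 𝒳) (X := 𝒩) v
    let Ts : Over (Spec (.of R)) := (LocApprox.baseDiagram p.primeCompl).obj s
    let πs : specOver R Rp ⟶ Ts := (LocApprox.baseCone p.primeCompl Rp).π.app s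
    have hw' : 𝒳 ◁ πs ≫ w = v := hw
    -- the generic fibre of `w`
    have hsK : IsUnit (algebraMap R K s.val) := hpc ⟨s.val, s.mem⟩
    letI : Algebra (LocApprox.loc p.primeCompl s) K :=
      (IsLocalization.Away.lift s.val hsK).toAlgebra
    haveI : IsScalarTower R (LocApprox.loc p.primeCompl s) K :=
      IsScalarTower.of_algebraMap_eq fun x => (IsLocalization.Away.lift_eq s.val hsK x).symm
    have hφs : specGenericPoint (LocApprox.loc p.primeCompl s) K ≫
        specOfAlgebraMap R (LocApprox.loc p.primeCompl s) = specGenericPoint R K :=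
      specGenericPoint_comp_specOfAlgebraMap R K _
    haveI : Mono (specOfAlgebraMap R (LocApprox.loc p.primeCompl s)) :=
      mono_specOfAlgebraMap_of_isLocalization (Submonoid.powers s.val) _
    have isos : IsIso ((genericFibre R K).map (fst 𝒳 Ts)) :=
      isIso_pullback_map_fst (specOfAlgebraMap R (LocApprox.loc p.primeCompl s))
        (specGenericPoint _ K) hφs 𝒳
    have isop : IsIso ((genericFibre R K).map (fst 𝒳 (specOver R Rp))) :=
      isIso_pullback_map_fst (specOfAlgebraMap R Rp) (specGenericPoint Rp K) hφp 𝒳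
    have isoc : IsIso ((genericFibre R K).map (𝒳 ◁ πs)) := by
      have h3 : IsIso ((genericFibre R K).map (𝒳 ◁ πs) ≫ (genericFibre R K).map (fst 𝒳 Ts)) := by
        rw [← Functor.map_comp, whiskerLeft_fst]
        exact isop
      exact @IsIso.of_isIso_comp_right _ _ _ _ _ _ _ isos h3
    have hwK : (genericFibre R K).map w = (genericFibre R K).map (fst 𝒳 Ts) ≫ u := by
      rw [← cancel_epi ((genericFibre R K).map (𝒳 ◁ πs)), ← Functor.map_comp, hw', hv',
        ← Functor.map_comp_assoc, whiskerLeft_fst]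
    -- glue `gf` (over `D(f)`) and `w` (over `D(s)`)
    let 𝒰 : (Spec (CommRingCat.of R)).OpenCover :=
      (Scheme.affineOpenCoverOfSpanRangeEqTop (R := .of R) (av s) (hspan s)).openCover
    let 𝒱 : 𝒳.left.OpenCover := 𝒰.pullback₁ 𝒳.hom
    let Xs : Over (Spec (.of R)) := 𝒳 ⊗ Ts
    let Xf : Over (Spec (.of R)) := 𝒳 ⊗ specOver R Rf
    have h𝒱f : 𝒱.f true = (fst 𝒳 (specOver R Rf)).left := rfl
    have h𝒱s : 𝒱.f false = (fst 𝒳 Ts).left := rfl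
    -- compatibility on the overlap (which lies over `D(f)`)
    have key : pullback.fst (𝒱.f true) (𝒱.f false) ≫ gf.left =
        pullback.snd (𝒱.f true) (𝒱.f false) ≫ w.left := by
      let W : Over (Spec (.of R)) := Over.mk (pullback.fst (𝒱.f true) (𝒱.f false) ≫ Xf.hom)
      have hW : Smooth W.hom := by
        change Smooth (pullback.fst (𝒱.f true) (𝒱.f false) ≫ Xf.hom)
        refine MorphismProperty.comp_mem _ _ _ ?_ hXf
        have : IsOpenImmersion (𝒱.f false) := 𝒱.map_prop false
        infer_instance
      let p₁ : W ⟶ Xf := Over.homMk (pullback.fst (𝒱.f true) (𝒱.f false)) rfl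
      have hcond : pullback.fst (𝒱.f true) (𝒱.f false) ≫ (fst 𝒳 (specOver R Rf)).left =
          pullback.snd (𝒱.f true) (𝒱.f false) ≫ (fst 𝒳 Ts).left := by
        rw [← h𝒱f, ← h𝒱s]
        exact pullback.condition
      have hp₂w : pullback.snd (𝒱.f true) (𝒱.f false) ≫ Xs.hom = W.hom := by
        change pullback.snd (𝒱.f true) (𝒱.f false) ≫ (fst 𝒳 Ts).left ≫ 𝒳.hom =
          pullback.fst (𝒱.f true) (𝒱.f false) ≫ (fst 𝒳 (specOver R Rf)).left ≫ 𝒳.hom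
        rw [← Category.assoc, ← hcond, Category.assoc]
      let p₂ : W ⟶ Xs := Over.homMk (pullback.snd (𝒱.f true) (𝒱.f false)) hp₂w
      have hp : p₁ ≫ fst 𝒳 (specOver R Rf) = p₂ ≫ fst 𝒳 Ts := by
        ext : 1
        exact hcond
      have hq : (pullback.fst (𝒱.f true) (𝒱.f false) ≫
          pullback.snd 𝒳.hom (specOfAlgebraMap R Rf)) ≫ specOfAlgebraMap R Rf = W.hom := by
        rw [Category.assoc]
        exact congrArg (pullback.fst (𝒱.f true) (𝒱.f false) ≫ ·) hqf
      have e : p₁ ≫ gf = p₂ ≫ w := (MPf W hW _ hq).1 (by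
        change (genericFibre R K).map (p₁ ≫ gf) = (genericFibre R K).map (p₂ ≫ w)
        simp only [Functor.map_comp, hgf', hwK]
        rw [← Category.assoc, ← Category.assoc, ← Functor.map_comp, ← Functor.map_comp, hp])
      exact congrArg CommaMorphism.left e
    let glf : ∀ b : Bool, 𝒱.X b ⟶ 𝒩.left := fun b => match b with
      | true => gf.left
      | false => w.left
    have hcompat : ∀ i j : Bool, pullback.fst (𝒱.f i) (𝒱.f j) ≫ glf i =
        pullback.snd (𝒱.f i) (𝒱.f j) ≫ glf j := by
      have hmono : ∀ b : Bool, Mono (𝒱.f b) := fun b => by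
        have : IsOpenImmersion (𝒱.f b) := 𝒱.map_prop b
        infer_instance
      rintro (_ | _) (_ | _)
      · rw [fst_eq_snd_of_mono_eq]
      · change pullback.fst (𝒱.f false) (𝒱.f true) ≫ w.left =
          pullback.snd (𝒱.f false) (𝒱.f true) ≫ gf.left
        rw [← pullbackSymmetry_hom_comp_snd (𝒱.f false) (𝒱.f true),
          ← pullbackSymmetry_hom_comp_fst (𝒱.f false) (𝒱.f true), Category.assoc,
          Category.assoc, key]
      · exact key
      · rw [fst_eq_snd_of_mono_eq]
    let gl : 𝒳.left ⟶ 𝒩.left := Scheme.Cover.glueMorphisms 𝒱 glf hcompat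
    have hgl : ∀ b, 𝒱.f b ≫ gl = glf b := fun b => Scheme.Cover.ι_glueMorphisms 𝒱 glf hcompat b
    have hover : gl ≫ 𝒩.hom = 𝒳.hom := by
      refine Scheme.Cover.hom_ext 𝒱 _ _ fun b => ?_
      rw [← Category.assoc, hgl]
      cases b
      · change w.left ≫ 𝒩.hom = 𝒱.f false ≫ 𝒳.hom
        rw [Over.w w]
        rfl
      · change gf.left ≫ 𝒩.hom = 𝒱.f true ≫ 𝒳.hom
        rw [Over.w gf]
        rfl
    refine ⟨Over.homMk gl hover, ?_⟩
    have hcf : fst 𝒳 (specOver R Rf) ≫ Over.homMk gl hover = gf := by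
      ext : 1
      exact hgl true
    haveI : IsIso ((genericFibre R K).map (fst 𝒳 (specOver R Rf))) :=
      isIso_pullback_map_fst (specOfAlgebraMap R Rf) (specGenericPoint Rf K) hφf 𝒳
    change (genericFibre R K).map (Over.homMk gl hover) = u
    rw [← cancel_epi ((genericFibre R K).map (fst 𝒳 (specOver R Rf))), ← Functor.map_comp, hcf,
      hgf']


/-- **Local criterion for the Néron property at one closed point** (the verification step of the
local-to-global passage in Bosch–Lütkebohmert–Raynaud, *Néron Models*, §1.4, via the local nature
of Néron models, §1.2 Prop. 4, and the limit arguments of EGA IV₃ §8). Let `R → K` be a ring with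
a field of fractions, `f ≠ 0` and `𝔭` a prime of `R` such that `𝔭` is the only prime containing
`f` (so `Spec R = D(f) ∪ {𝔭}`). Let `𝒩 → Spec R` be smooth, separated and of finite type, and
suppose that `𝒩 ×_R R[1/f]` is a Néron model of the `K`-scheme `E` over (every model of) `R[1/f]`
and `𝒩 ×_R R_𝔭` is one over (every model of) `R_𝔭`, in the group-free sense
`IsSchematicNeronModel`. Then `𝒩` is a Néron model of `E` over `R`. Proof of the mapping property,
for a smooth `R`-scheme `𝒳` which we may take affine (`bijective_map_of_isAffine`): a morphism
`𝒳_K → 𝒩_K` extends over `𝒳 ×_R R[1/f]` (Néron property over `D(f)`) and over `𝒳 ×_R R_𝔭`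
(Néron property over `R_𝔭`); the latter extension spreads out to `𝒳 ×_R R[1/s]` for some `s ∉ 𝔭`
because `𝒳 ×_R R_𝔭 = lim_{s ∉ 𝔭} 𝒳 ×_R R[1/s]` and `𝒩` is locally of finite presentation
(`LocApprox.exists_whiskerLeft_comp_eq`, Stacks 01ZC); the two extensions agree on the overlap,
which lies over `D(f)`, and glue along `Spec R = D(f) ∪ D(s)`. Uniqueness likewise: two
extensions agree over `D(f)`, agree after base change to `R_𝔭`, hence over some `D(s)`
(`LocApprox.exists_whiskerLeft_map_comp_eq`), hence everywhere.
[cite: BLRNeronModels1990, §1.2 (Prop. 4, local nature) and §1.4 (local-to-global passage)] -/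
theorem IsSchematicNeronModel.of_away_of_atPrime (f : R) (hf : f ≠ 0) (p : Ideal R) [p.IsPrime]
    (hV : ∀ q : Ideal R, q.IsPrime → f ∈ q → q = p)
    (hsm : Smooth 𝒩.hom) (hsep : IsSeparated 𝒩.hom) (hlft : LocallyOfFiniteType 𝒩.hom)
    (hqc : QuasiCompact 𝒩.hom)
    (Hf : ∀ (R' : Type u) [CommRing R'] [Algebra R R'] [IsLocalization.Away f R'] [Algebra R' K]
      [IsScalarTower R R' K],
      IsSchematicNeronModel R' K ((Over.pullback (specOfAlgebraMap R R')).obj 𝒩) E)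
    (Hp : ∀ (R' : Type u) [CommRing R'] [Algebra R R'] [IsLocalization.AtPrime R' p] [Algebra R' K]
      [IsScalarTower R R' K],
      IsSchematicNeronModel R' K ((Over.pullback (specOfAlgebraMap R R')).obj 𝒩) E) :
    IsSchematicNeronModel R K 𝒩 E := by
  -- the models `R_f = R[1/f]`, `R_𝔭` with their maps to `K`
  have hfK : IsUnit (algebraMap R K f) :=
    isUnit_iff_ne_zero.mpr ((map_ne_zero_iff _ (IsFractionRing.injective R K)).mpr hf)
  letI : Algebra (Localization.Away f) K := (IsLocalization.Away.lift f hfK).toAlgebra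
  haveI : IsScalarTower R (Localization.Away f) K :=
    IsScalarTower.of_algebraMap_eq fun x => (IsLocalization.Away.lift_eq f hfK x).symm
  have hpc : ∀ y : p.primeCompl, IsUnit (algebraMap R K y) := fun y =>
    isUnit_iff_ne_zero.mpr ((map_ne_zero_iff _ (IsFractionRing.injective R K)).mpr
      fun h => y.2 (h ▸ p.zero_mem))
  letI : Algebra (Localization.AtPrime p) K :=
    (IsLocalization.lift (M := p.primeCompl) hpc).toAlgebra
  haveI : IsScalarTower R (Localization.AtPrime p) K :=
    IsScalarTower.of_algebraMap_eq fun x => (IsLocalization.lift_eq hpc x).symm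
  exact IsSchematicNeronModel.of_away_of_atPrime_of_models f p hV hsm hsep hlft hqc
    (Localization.Away f) (Localization.AtPrime p) (Hf _) (Hp _)

end LocalCriterion

end Literature.NumberTheory.EllipticCurves

end
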